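import Literature.AlgebraicGeometry.Resolution.RegularLocalRingsQuotient
import Mathlib.RingTheory.LocalRing.RingHom.Basic
import HarnessLib

/-!
# [OURS · L1 W4.5(b) · EL♮(3) · NU7 §A2 «Σ1 SMOOTHING LEMMA», part 2a] THE ONE-BAD-RESIDUE DICHOTOMY AND THE HYPERSURFACE CRITERION
# THROUGH A SURJECTIVE LOCAL HOMOMORPHISM (ring lemmas)

res-L1-w45b-stub-2 g19 (STUB WORKER 2), desk RULING R70 (iii).  OURS; NOT a statement of any manuscript ([Hironaka2017] is a candidate under
adjudication — nothing of it is asserted here); AI-written, weaker than expert review.  No `sorry`; standard axioms; DEF-FREE.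
`--supports stmt-ResolutionOfSingularities-20148 --as helper`, counted 0.  EL♮(3) is NOT proved; resolution in positive characteristic is NOT proved.

WHAT (pure commutative algebra, for the stalk step of the Σ1 smoothing lemma `planar_trace_smoothing`):
* `one_bad_residue` — in any commutative ring with an ideal `J ∌ w`: the elements `G + c₁·w·M` and `G + c₂·w·M` are NOT both in `J` when `M` and
  `c₁ - c₂` are units (so, per point, at most ONE residue class of the parameter `c` is bad).
* `notMem_ker_sup_sq_of_map_notMem_sq` / `map_notMem_sq_of_notMem_ker_sup_sq` — for a SURJECTIVE local homomorphism `π : B → B'` of local rings,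
  `π a ∉ 𝔪'²  ↔  a ∉ ker π ⊔ 𝔪²` (`π(𝔪²) = 𝔪'²`).
* ★ `isRegularLocalRing_quotient_ker_sup_span` — the HYPERSURFACE CRITERION pulled back: `π : B ↠ B'` surjective local, `B'` a regular local ring,
  `F ∈ 𝔪_B` with `F ∉ ker π ⊔ 𝔪_B²`; then `B ⧸ (ker π ⊔ (F))` is a regular local ring (it is `B' ⧸ (π F)`, Matsumura 14.2 ✓
  `IsRegularLocalRing.quotient_span_singleton`).
References (method / index only): H. Matsumura, *Commutative Ring Theory* (1986), Thm. 14.2.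
-/

set_option linter.dupNamespace false -- mandated namespace `Summit.<Summit>.<Problem>` of this single-conjunct summit

noncomputable section

open IsLocalRing Literature.AlgebraicGeometry.Resolution

namespace Summit.ResolutionOfSingularities.ResolutionOfSingularities.Cruxes.EquisingularLiftNat.Sections.PlanarSmoothing

/-! ## The one-bad-residue dichotomy -/

/-- **At most one bad residue.**  `J` an ideal with `w ∉ J`, `M` a unit, `c₁ - c₂` a unit: `G + c₁ w M` and `G + c₂ w M` are not both in `J`.
[folklore] -/
theorem one_bad_residue {B : Type*} [CommRing B] (J : Ideal B) {w M G c₁ c₂ : B} (hw : w ∉ J) (hM : IsUnit M) (hc : IsUnit (c₁ - c₂))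
    (h₁ : G + c₁ * w * M ∈ J) (h₂ : G + c₂ * w * M ∈ J) : False := by
  apply hw
  have hsub : (c₁ - c₂) * M * w ∈ J := by
    have h := J.sub_mem h₁ h₂
    have e : G + c₁ * w * M - (G + c₂ * w * M) = (c₁ - c₂) * M * w := by ring
    rwa [e] at h
  obtain ⟨u, hu⟩ := hc.mul hM
  have h3 := J.mul_mem_left (↑u⁻¹ : B) hsub
  rwa [← mul_assoc, ← hu, Units.inv_mul, one_mul] at h3

/-! ## Squares of maximal ideals under a surjective local homomorphism -/

section LocalHom

variable {B B' : Type*} [CommRing B] [CommRing B'] [IsLocalRing B] [IsLocalRing B'] (π : B →+* B') [IsLocalHom π]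

/-- A surjective local homomorphism maps the maximal ideal ONTO the maximal ideal. [folklore] -/
theorem map_maximalIdeal_of_surjective (hπ : Function.Surjective π) : (maximalIdeal B).map π = maximalIdeal B' := by
  have hloc : IsLocalHom π := inferInstance
  have hcomap : (maximalIdeal B').comap π = maximalIdeal B := ((IsLocalRing.local_hom_TFAE π).out 0 4).mp hloc
  rw [← hcomap, Ideal.map_comap_of_surjective π hπ]

/-- `π a ∉ 𝔪'² ⇒ a ∉ ker π ⊔ 𝔪²` (any local homomorphism). [folklore] -/
theorem notMem_ker_sup_sq_of_map_notMem_sq {a : B} (ha : π a ∉ maximalIdeal B' ^ 2) : a ∉ RingHom.ker π ⊔ maximalIdeal B ^ 2 := by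
  intro hmem
  apply ha
  obtain ⟨u, hu, m, hm, rfl⟩ := Submodule.mem_sup.mp hmem
  rw [map_add, (RingHom.mem_ker).mp hu, zero_add]
  have hloc : IsLocalHom π := inferInstance
  have hle : (maximalIdeal B ^ 2).map π ≤ maximalIdeal B' ^ 2 := by
    rw [Ideal.map_pow]
    exact Ideal.pow_right_mono (((IsLocalRing.local_hom_TFAE π).out 0 2).mp hloc) 2
  exact hle (Ideal.mem_map_of_mem π hm)

/-- `a ∉ ker π ⊔ 𝔪² ⇒ π a ∉ 𝔪'²` for `π` SURJECTIVE local (`𝔪'² = π(𝔪²)`). [folklore] -/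
theorem map_notMem_sq_of_notMem_ker_sup_sq (hπ : Function.Surjective π) {a : B} (ha : a ∉ RingHom.ker π ⊔ maximalIdeal B ^ 2) :
    π a ∉ maximalIdeal B' ^ 2 := by
  intro hmem
  apply ha
  rw [← map_maximalIdeal_of_surjective π hπ, ← Ideal.map_pow] at hmem
  obtain ⟨m, hm, hπm⟩ := (Ideal.mem_map_iff_of_surjective π hπ).mp hmem
  have hdiff : a - m ∈ RingHom.ker π := by rw [RingHom.mem_ker, map_sub, hπm, sub_self]
  have h := Submodule.add_mem_sup hdiff hm
  rwa [sub_add_cancel] at h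

end LocalHom

section Criterion

variable {B B' : Type*} [CommRing B] [CommRing B'] [IsLocalRing B] [IsRegularLocalRing B'] (π : B →+* B') [IsLocalHom π]

/-- ★ **The hypersurface criterion through a surjective local homomorphism.**  `π : B ↠ B'` surjective local, `B'` regular local, `F ∈ 𝔪_B` with
`F ∉ ker π ⊔ 𝔪_B²`: then `B ⧸ (ker π ⊔ (F))` is a regular local ring — it is `B' ⧸ (π F)` with `π F ∈ 𝔪' ∖ 𝔪'²`. [cite: Matsumura1987, Thm. 14.2] -/
theorem isRegularLocalRing_quotient_ker_sup_span (hπ : Function.Surjective π) {F : B} (hFm : F ∈ maximalIdeal B)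
    (hF : F ∉ RingHom.ker π ⊔ maximalIdeal B ^ 2) : IsRegularLocalRing (B ⧸ (RingHom.ker π ⊔ Ideal.span {F})) := by
  have hloc : IsLocalHom π := inferInstance
  have hmaple : (maximalIdeal B).map π ≤ maximalIdeal B' := ((IsLocalRing.local_hom_TFAE π).out 0 2).mp hloc
  have hπFm : π F ∈ maximalIdeal B' := hmaple (Ideal.mem_map_of_mem π hFm)
  have hπF2 : π F ∉ maximalIdeal B' ^ 2 := map_notMem_sq_of_notMem_ker_sup_sq π hπ hF
  have hreg := (IsRegularLocalRing.quotient_span_singleton hπFm hπF2).1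
  -- `B → B' → B'/(πF)` is onto with kernel `ker π ⊔ (F)`
  let ρ : B →+* B' ⧸ Ideal.span {π F} := (Ideal.Quotient.mk (Ideal.span {π F})).comp π
  have hρ : Function.Surjective ρ := Ideal.Quotient.mk_surjective.comp hπ
  have hker : RingHom.ker ρ = RingHom.ker π ⊔ Ideal.span {F} := by
    change RingHom.ker ((Ideal.Quotient.mk (Ideal.span {π F})).comp π) = _
    rw [← RingHom.comap_ker, Ideal.mk_ker, ← Set.image_singleton, ← Ideal.map_span, Ideal.comap_map_of_surjective π hπ, sup_comm]
    rfl
  exact IsRegularLocalRing.of_ringEquiv ((RingHom.quotientKerEquivOfSurjective hρ).symm.trans (Ideal.quotEquivOfEq hker))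

end Criterion


end Summit.ResolutionOfSingularities.ResolutionOfSingularities.Cruxes.EquisingularLiftNat.Sections.PlanarSmoothing

end
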